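import Literature.Geometry.DiscreteGeometry.KissingRigidity
import Summits.AtomisticToContinuum.Crystallization.Theorems.FrustratedLawDichotomySphericalLinkCert
import Summits.AtomisticToContinuum.Crystallization.Theorems.HullExactificationCascadeZeroDefectDensityCapAtomsPattern
import Summits.AtomisticToContinuum.Crystallization.Theorems.PricedLinkCensusSoftFourRingsCapEndgame
import Summits.AtomisticToContinuum.Crystallization.Theorems.PricedLinkCensusSoftFourRingsCapCertD8Check

/-!
# FrustratedLawDichotomy · `G` AT ONE PERCENT IS A THEOREM: `LinkCert (1/100)` from the certified `Cap` chain
# (decomp-a2c, lens-3 g31 — the G-bridge of the 31280 slot-3 inventory, critic row 611 (2))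

`G = LinkClassification θ` (the θ-bond graph of the twelve neighbours of a charge-free site is the cubocta- or the
anticuboctahedron) was reduced to the finite certificate `LinkCert θ` (`…FrustratedLawDichotomyLinkCert`, p821557) and
further to its spherical form `SphericalLinkCert θ` (`…FrustratedLawDichotomySphericalLinkCert`: twelve UNIT vectors, a
4-regular graph `B` on `Fin 12`, three cosine windows).  At `θ = 1/100` the three windows are LITERALLY the hull-level
setting of the `PricedLinkCensus` soft-four-rings chain:

* every pair      `⟪e u, e v⟫ ≤ 1 − (1+θ)⁻²/2 = 1 − 1/(2·1.01²)`   (`hsepX` of `Cap.bond_graph_fcc_or_hcp`),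
* `B`-bonds       `⟪e u, e v⟫ ≥ 1 − (1+θ)²/2  = 1 − 1.01²/2`       (`hB`),
* `B`-non-bonds   `⟪e u, e v⟫ < (1+θ)/2       = 101/200`           (the extra hypothesis of `Cap.BondToCap`),

so `SphericalLinkCert (1/100)` is the conjunction of two ACCEPTED tree theorems read through a dictionary:
`Cap.bondToCap_holds : BondToCap` (…CapCertD8Check: covering radius `< 57.175°` of the twelve directions, an SDP
certificate replayed by `decide` — no `native_decide` in its closure) supplies the covering hypothesis `hT`, and
`Cap.bond_graph_fcc_or_hcp` (…CapEndgame) then labels the twelve directions by `Fin 12` with `B ↔ fccAdj` or `B ↔ hcpAdj`.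

THE DICTIONARY (bookkeeping, no numerics): directions `e : Fin 12 → S²` ↦ `X := univ.image e` (card `12` because
distinct directions are at cosine `≤ 0.51 < 1`); the graph `B` ↦ `Bset := B.edgeFinset.image (z ↦ (z.map e).toFinset)`
(card `24` by the handshake lemma and 4-regularity; `{e a, e b} ∈ Bset ↔ B.Adj a b`); the four partners of a direction
↦ an enumeration `Fin 4 ≃ B.neighborSet u`; back: the labelling `p : Fin 12 → X` of the endgame ↦ a permutation `σ` of
`Fin 12` with `B.Adj (σ i) (σ j) ↔ fccAdj i j`, composed with the pattern charts `Fin 12 ≃ ↥fccKissingPattern`,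
`dist = 1 ↔ fccAdj` (`ZeroDefectDensityBirth.fcc_chart` / `hcp_chart` of
`…HullExactificationCascadeZeroDefectDensityCapAtomsPattern`, imported).

## Results
* `sphericalLinkCert_hundredth_of_cap : BondToCap → ⟨statement of Cap.bond_graph_fcc_or_hcp⟩ → SphericalLinkCert (1/100)`
  — the dictionary, with the two `Cap` theorems as displayed hypotheses (§2);
* ★ `sphericalLinkCert_hundredth : SphericalLinkCert (1/100)` (§3, the two hypotheses discharged by name);
* ★ `linkCert_hundredth : LinkCert (1/100)` (by `linkCert_of_spherical`);
* ★ `linkClassification_hundredth : LinkClassification (1/100)` — `G` of the dichotomy column / of the 31280 slot-3 cut,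
  now hypothesis-free (consumers: `OverbindingBudgetTwoShellCover.twoShellShapeV_of_G_P_Mboth` / `…_of_certs`,
  `FrustratedLawDichotomyLinkCert.kr2Shape_of_linkCert`, the 27623 / 26654 chains — each loses its `G` argument).

`[folklore]` glue over accepted theorems; no `sorry`; no new definitions; no `instance`/`notation`; no `native_decide`.
-/

noncomputable section

namespace Summit.AtomisticToContinuum.Crystallization.Theorems.FrustratedLawDichotomyLinkCertOfCap

open Real RealInnerProductSpace
open Literature.Geometry.DiscreteGeometry
open Summit.AtomisticToContinuum.Crystallization.Theorems.FrustratedLawDichotomyTwoShellRigidityCut (E3 LinkClassification)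
open Summit.AtomisticToContinuum.Crystallization.Theorems.FrustratedLawDichotomyLinkCert (LinkCert linkClassification_of_linkCert)
open Summit.AtomisticToContinuum.Crystallization.Theorems.FrustratedLawDichotomySphericalLinkCert
  (SphericalLinkCert linkCert_of_spherical)
open Summit.AtomisticToContinuum.Crystallization.Theorems.ZeroDefectDensityBirth (fcc_chart hcp_chart)

/-! ### §1 Dictionary lemmas: unordered pairs; the three window literals (the pattern charts `fcc_chart` /
`hcp_chart` are imported from `…ZeroDefectDensityBirth`) -/

/-- Two unordered pairs of points are equal as finsets iff they are equal up to order. [folklore] -/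
theorem pair_eq_pair_iff {a b c d : E3} :
    ({a, b} : Finset E3) = {c, d} ↔ (a = c ∧ b = d) ∨ (a = d ∧ b = c) := by
  rw [← Finset.coe_inj, Finset.coe_pair, Finset.coe_pair, Set.pair_eq_pair_iff]

/-- The three literals of `SphericalLinkCert (1/100)` are the `Cap` constants. [folklore] -/
theorem sep_const : (1 : ℝ) - (1 + 1 / 100)⁻¹ ^ 2 / 2 = 1 - 1 / (2 * (101 / 100 : ℝ) ^ 2) := by norm_num

/-- See `sep_const`. [folklore] -/
theorem bond_const : (1 : ℝ) - (1 + 1 / 100) ^ 2 / 2 = 1 - (101 / 100 : ℝ) ^ 2 / 2 := by norm_num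

/-- See `sep_const`. [folklore] -/
theorem nonbond_const : ((1 : ℝ) + 1 / 100) / 2 = 101 / 200 := by norm_num

/-! ### §2 The dictionary: `SphericalLinkCert (1/100)` from the two `Cap` statements as hypotheses -/

/-- **The dictionary.**  If the hull-level covering statement `Cap.BondToCap` holds and the hull-level endgame
(the statement of `Cap.bond_graph_fcc_or_hcp`: twelve unit directions with the three cosine windows, covering radius
`< 57.175°`, `24` bonds, four at each direction ⟹ a labelling by `Fin 12` with bond set `fccAdj` or `hcpAdj`) holds,
then `SphericalLinkCert (1/100)`.  Both hypotheses are accepted tree theorems (§3). [folklore] -/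
theorem sphericalLinkCert_hundredth_of_cap (hcap : Cap.BondToCap)
    (hend : ∀ {X : Finset E3} {B : Finset (Finset E3)},
      (∀ p : E3, ‖p‖ = 1 → ∃ x ∈ X, dist p x < 0.957) →
      (∀ y ∈ X, ‖y‖ = 1) → X.card = 12 →
      (∀ u ∈ X, ∀ u' ∈ X, u ≠ u' → ⟪u, u'⟫ ≤ 1 - 1 / (2 * (101 / 100 : ℝ) ^ 2)) →
      (∀ T ∈ B, ∃ u ∈ X, ∃ u' ∈ X, u ≠ u' ∧ 1 - (101 / 100 : ℝ) ^ 2 / 2 ≤ ⟪u, u'⟫ ∧ T = {u, u'}) →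
      B.card = 24 →
      (∀ v ∈ X, ∃ w : Fin 4 → E3, (∀ k, w k ∈ X) ∧ Function.Injective w ∧ (∀ k, w k ≠ v) ∧
        (∀ k, ({v, w k} : Finset E3) ∈ B) ∧ ∀ y, ({v, y} : Finset E3) ∈ B → ∃ k, y = w k) →
      ∃ p : Fin 12 → E3, Function.Injective p ∧ (∀ i, p i ∈ X) ∧
        ((∀ i j, ({p i, p j} : Finset E3) ∈ B ↔ fccAdj i j) ∨ (∀ i j, ({p i, p j} : Finset E3) ∈ B ↔ hcpAdj i j))) :
    SphericalLinkCert (1 / 100) := by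
  classical
  intro e B hunit hsep hbond hnon hreg
  -- the three windows with the `Cap` literals
  have hsep' : ∀ u v, u ≠ v → ⟪e u, e v⟫ ≤ 1 - 1 / (2 * (101 / 100 : ℝ) ^ 2) := fun u v huv => by
    rw [← sep_const]; exact hsep u v huv
  have hbond' : ∀ u v, B.Adj u v → 1 - (101 / 100 : ℝ) ^ 2 / 2 ≤ ⟪e u, e v⟫ := fun u v h => by
    rw [← bond_const]; exact hbond u v h
  have hnon' : ∀ u v, u ≠ v → ¬ B.Adj u v → ⟪e u, e v⟫ < 101 / 200 := fun u v huv h => by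
    rw [← nonbond_const]; exact hnon u v huv h
  -- distinct labels carry distinct directions
  have hinj : Function.Injective e := by
    intro u v h
    by_contra huv
    have h1 := hsep' u v huv
    rw [h, real_inner_self_eq_norm_sq, hunit v] at h1
    norm_num at h1
  have hne : ∀ {u v}, u ≠ v → e u ≠ e v := fun huv h => huv (hinj h)
  -- the twelve directions as a finset
  obtain ⟨X, hX⟩ : ∃ X : Finset E3, X = Finset.univ.image e := ⟨_, rfl⟩
  have hmemX : ∀ u, e u ∈ X := fun u => hX ▸ Finset.mem_image_of_mem e (Finset.mem_univ u)
  have hXe : ∀ {y}, y ∈ X → ∃ u, e u = y := fun {y} hy => by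
    rw [hX] at hy
    obtain ⟨u, -, hu⟩ := Finset.mem_image.1 hy
    exact ⟨u, hu⟩
  have hX1 : ∀ y ∈ X, ‖y‖ = 1 := by
    intro y hy
    obtain ⟨u, rfl⟩ := hXe hy
    exact hunit u
  have hcard : X.card = 12 := by
    rw [hX, Finset.card_image_of_injective _ hinj, Finset.card_univ, Fintype.card_fin]
  have hsepX : ∀ u ∈ X, ∀ u' ∈ X, u ≠ u' → ⟪u, u'⟫ ≤ 1 - 1 / (2 * (101 / 100 : ℝ) ^ 2) := by
    intro y hy y' hy' hne'
    obtain ⟨u, rfl⟩ := hXe hy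
    obtain ⟨v, rfl⟩ := hXe hy'
    exact hsep' u v (fun h => hne' (by rw [h]))
  -- the bonds as a finset of two-element finsets
  obtain ⟨pr, hpr_def⟩ : ∃ pr : Sym2 (Fin 12) → Finset E3, ∀ z, pr z = (z.map e).toFinset := ⟨_, fun _ => rfl⟩
  have hpr : ∀ a b, pr s(a, b) = {e a, e b} := fun a b => by
    rw [hpr_def, Sym2.map_mk, Sym2.toFinset_mk_eq]
  have hpr_inj : Function.Injective pr := by
    intro z w
    induction z with
    | h a b =>
      induction w with
      | h c d =>
        intro h
        rw [hpr, hpr, pair_eq_pair_iff] at h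
        rcases h with ⟨h1, h2⟩ | ⟨h1, h2⟩
        · exact Sym2.eq_iff.2 (Or.inl ⟨hinj h1, hinj h2⟩)
        · exact Sym2.eq_iff.2 (Or.inr ⟨hinj h1, hinj h2⟩)
  obtain ⟨Bset, hBset⟩ : ∃ Bset : Finset (Finset E3), Bset = B.edgeFinset.image pr := ⟨_, rfl⟩
  have hmemB : ∀ {a b}, ({e a, e b} : Finset E3) ∈ Bset ↔ B.Adj a b := by
    intro a b
    rw [← hpr, hBset]
    constructor
    · intro h
      obtain ⟨z, hz, hzab⟩ := Finset.mem_image.1 h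
      obtain rfl : z = s(a, b) := hpr_inj hzab
      exact (SimpleGraph.mem_edgeFinset.1 hz :)
    · intro h
      exact Finset.mem_image.2 ⟨s(a, b), SimpleGraph.mem_edgeFinset.2 h, rfl⟩
  have hB : ∀ T ∈ Bset, ∃ u ∈ X, ∃ u' ∈ X, u ≠ u' ∧ 1 - (101 / 100 : ℝ) ^ 2 / 2 ≤ ⟪u, u'⟫ ∧ T = {u, u'} := by
    intro T hT
    rw [hBset] at hT
    obtain ⟨z, hz, rfl⟩ := Finset.mem_image.1 hT
    induction z with
    | h a b =>
      have hab : B.Adj a b := SimpleGraph.mem_edgeFinset.1 hz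
      exact ⟨e a, hmemX a, e b, hmemX b, hne hab.ne, hbond' a b hab, hpr a b⟩
  -- degrees and the number of bonds
  have hdeg4 : ∀ u, B.degree u = 4 := by
    intro u
    rw [← SimpleGraph.card_neighborSet_eq_degree, ← Nat.card_eq_fintype_card, Nat.card_coe_set_eq]
    exact hreg u
  have hBcard : Bset.card = 24 := by
    rw [hBset, Finset.card_image_of_injective _ hpr_inj]
    have h := B.sum_degrees_eq_twice_card_edges
    simp only [hdeg4, Finset.sum_const, Finset.card_univ, Fintype.card_fin, smul_eq_mul] at h
    omega
  -- the four partners of a direction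
  have hdegX : ∀ v ∈ X, ∃ w : Fin 4 → E3, (∀ k, w k ∈ X) ∧ Function.Injective w ∧ (∀ k, w k ≠ v) ∧
      (∀ k, ({v, w k} : Finset E3) ∈ Bset) ∧ ∀ y, ({v, y} : Finset E3) ∈ Bset → ∃ k, y = w k := by
    intro y hy
    obtain ⟨u, rfl⟩ := hXe hy
    have hcardN : Fintype.card ↥(B.neighborSet u) = Fintype.card (Fin 4) := by
      rw [SimpleGraph.card_neighborSet_eq_degree, hdeg4, Fintype.card_fin]
    obtain ⟨f⟩ := Fintype.card_eq.1 hcardN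
    obtain ⟨nb, hnb⟩ : ∃ nb : Fin 4 → Fin 12, ∀ k, nb k = ((f.symm k : ↥(B.neighborSet u)) : Fin 12) :=
      ⟨_, fun _ => rfl⟩
    have hnb_adj : ∀ k, B.Adj u (nb k) := fun k => by rw [hnb]; exact (f.symm k).2
    have hnb_inj : Function.Injective nb := fun k l h => by
      rw [hnb, hnb] at h
      exact f.symm.injective (Subtype.ext h)
    have hnb_surj : ∀ v, B.Adj u v → ∃ k, nb k = v := fun v hv =>
      ⟨f ⟨v, hv⟩, by rw [hnb, Equiv.symm_apply_apply]⟩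
    refine ⟨fun k => e (nb k), fun k => hmemX _, hinj.comp hnb_inj, fun k => (hne (hnb_adj k).ne).symm,
      fun k => hmemB.2 (hnb_adj k), ?_⟩
    intro y' hy'
    rw [hBset] at hy'
    obtain ⟨z, hz, hzy⟩ := Finset.mem_image.1 hy'
    induction z with
    | h a b =>
      have hab : B.Adj a b := SimpleGraph.mem_edgeFinset.1 hz
      rw [hpr, pair_eq_pair_iff] at hzy
      rcases hzy with ⟨h1, h2⟩ | ⟨h1, h2⟩
      · obtain rfl : a = u := hinj h1
        obtain ⟨k, hk⟩ := hnb_surj b hab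
        exact ⟨k, by simp only [hk, h2]⟩
      · obtain rfl : b = u := hinj h2
        obtain ⟨k, hk⟩ := hnb_surj a hab.symm
        exact ⟨k, by simp only [hk, h1]⟩
  -- non-bonds
  have hnb : ∀ u ∈ X, ∀ u' ∈ X, u ≠ u' → ({u, u'} : Finset E3) ∉ Bset → ⟪u, u'⟫ < 101 / 200 := by
    intro y hy y' hy' hne' hnot
    obtain ⟨u, rfl⟩ := hXe hy
    obtain ⟨v, rfl⟩ := hXe hy'
    exact hnon' u v (fun h => hne' (by rw [h])) (fun h => hnot (hmemB.2 h))
  -- the covering property of the twelve directions (bond-to-cap)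
  have hT : ∀ p : E3, ‖p‖ = 1 → ∃ x ∈ X, dist p x < 0.957 := hcap X Bset hX1 hcard hsepX hB hBcard hdegX hnb
  -- the endgame: the bond graph is the cuboctahedron or the anticuboctahedron
  obtain ⟨p, hpinj, hpX, hiso⟩ := hend hT hX1 hcard hsepX hB hBcard hdegX
  -- pull the labelling back to `Fin 12`
  choose σ hσ using fun i => hXe (hpX i)
  have hσinj : Function.Injective σ := fun i j h => hpinj (by rw [← hσ i, ← hσ j, h])
  have hσbij : Function.Bijective σ := Finite.injective_iff_bijective.1 hσinj
  have hadjσ : ∀ i j, ({p i, p j} : Finset E3) ∈ Bset ↔ B.Adj (σ i) (σ j) := fun i j => by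
    rw [← hσ i, ← hσ j]; exact hmemB
  rcases hiso with hf | hh
  · obtain ⟨f, hfadj⟩ := fcc_chart
    refine Or.inl ⟨σ ∘ f.symm, hσbij.comp f.symm.bijective, fun u v => ?_⟩
    rw [Function.comp_apply, Function.comp_apply, ← hadjσ, hf, ← hfadj, Equiv.apply_symm_apply,
      Equiv.apply_symm_apply]
  · obtain ⟨f, hfadj⟩ := hcp_chart
    refine Or.inr ⟨σ ∘ f.symm, hσbij.comp f.symm.bijective, fun u v => ?_⟩
    rw [Function.comp_apply, Function.comp_apply, ← hadjσ, hh, ← hfadj, Equiv.apply_symm_apply,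
      Equiv.apply_symm_apply]

-- §3-MARKER (the check form ends here)
/-! ### §3 ★ `G` by name: the two hypotheses are the accepted `Cap` theorems -/

/-- ★ **`G` on the sphere at one percent is a theorem.** [folklore] -/
theorem sphericalLinkCert_hundredth : SphericalLinkCert (1 / 100) :=
  sphericalLinkCert_hundredth_of_cap Cap.bondToCap_holds
    (fun hT hX1 hcard hsepX hB hBcard hdeg => Cap.bond_graph_fcc_or_hcp hT hX1 hcard hsepX hB hBcard hdeg)

/-- ★ **`LinkCert (1/100)`** — the ℚ-mirror of `G` is a theorem. [folklore] -/
theorem linkCert_hundredth : LinkCert (1 / 100) :=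
  linkCert_of_spherical (by norm_num) (by norm_num) sphericalLinkCert_hundredth

/-- ★ **`G = LinkClassification (1/100)`** — hypothesis-free. [folklore] -/
theorem linkClassification_hundredth : LinkClassification (1 / 100) :=
  linkClassification_of_linkCert linkCert_hundredth

end Summit.AtomisticToContinuum.Crystallization.Theorems.FrustratedLawDichotomyLinkCertOfCap

end
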